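import Summits.QuantumFields.YangMills.Theorems.PoincareLipschitzSkewProjection
import Summits.QuantumFields.YangMills.Theorems.UnitScaleTiltProp7FibreRemainderL1Level
import Summits.QuantumFields.YangMills.Theorems.UnitScaleTiltProp7TrueLinIterDefect
import HarnessLib

/-!
# Crux stmt-QuantumFields-19936 `UnitScaleTilt.HistoryTailL`, K2 at depth (route crux `PoincareLipschitz.BlockLipschitzL`, stmt-QuantumFields-23533),
# K2 supplier plan of record (card v1.27 (c)), file F5b-3 — ONE LEVEL OF THE RE-GAUGED NONLINEAR TOWER IN `ℓ²`:
# `‖Y(Ū, W̄^g)‖_{ℓ²(T)} ≤ (ρ + κ·(159α + 520·C₁M))·M`, `M = ‖Y(V, W)‖_{ℓ²(S)}`, `ρ = √((L^d)⁻¹L²)` (= `L^{−1/2}` at d = 3)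

Cell `ym3-torus` (YM ladder rung R3 = continuum SU(2) Yang–Mills on the three-torus — a RUNG, NOT the Clay problem: not d = 4, not infinite
volume, not a mass gap); width seat `ym-ust-19936-w2` g10, pen F5 of the K2 supplier plan (LEAD `ym-ust-19936-w1` g7, 2026-08-29T00:35:51Z;
memo `R4-LOCATE-w2g10.md` §3).  Helper `--supports stmt-QuantumFields-19936`; THEOREMS ONLY (0 `def`, 0 `sorry`); level- and `Params`-generic,
gauge group `SU(2)`.  Nothing here proves `hStab`, a stub, `BlockLipschitzL`, `HistoryTailL` or a summit statement.

THE STEP.  `V, W` level-`j` `SU(2)` fields, `Y = pertVar V W`, a set `T` of coarse bonds whose two-block neighbourhoods lie in a set `S` of fine bonds,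
`M² ≥ Σ_{b∈S}‖Y b‖²`, (0.4) loop variables of `V` at the bonds of `T` within `α ≤ 1/24` of `1`.  Re-gauge `W̄ = avgFun ℰ W` by `g = exp(−CM_Z)`,
`Z` the skew projection of `Y` (✓`PoincareLipschitzSkewProjection`, `𝔰𝔲(2)`-valued, so `g` is an honest gauge transformation —
✓`PoincareLipschitzRegaugeAbsorption.exists_gaugeTransf_coe_eq_exp_neg`).  Pointwise at `c ∈ T` the re-gauged ratio is
`LINE_V Y(c) + O((α + m_*)·m(c))` (✓`PoincareLipschitzRegaugedStep.norm_pertVar_avgFun_regauged_le_nbhdMass`, `m(c) = (d+2)L·S(c)`,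
`δ(c) ≤ m(c)²/2` by ✓`norm_combMean_skewPart_sub_le_nbhdMass`, `m(c) ≤ m_* := C₁·M`, `C₁ = (d+2)L·√(2dL^d)` by ✓`nbhdMass_sq_le`); in `ℓ²(T)`
Minkowski (✓`Prop7TrueLinIterDefect.sqrt_sum_norm_add_sq_le`) with the two BOX-LOCAL rows — the line mean contracts, `Σ_T‖LINE‖² ≤ ρ²Σ_S‖Y‖²`
(ROW-L), and the neighbourhood masses have multiplicity `2d`, `Σ_T Σ_{N(c)} ≤ 2d·Σ_S` (ROW-M) — gives the title with `κ = (d+2)L·√((2dL^d)(2d))`.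
ROW-L∕ROW-M are the box-local twins of ✓`Prop7TrueLinLineBound.sum_normSq_line_le` ∕ ✓`Prop7TrueLinDefectBound.sum_nbhd_le` (pen: `ym3-torus-px7`,
file F4 of the plan); here they are DISPLAYED as hypotheses on `(T, S)` in the agreed `⊇`-form, to be discharged by name when F4 lands.

WHAT IS PROVED (ns `…Theorems.PoincareLipschitzRegaugedTowerStep`).
* §1 `sum_le_sum_of_nbhd_subset`, `nbhdMass_le_of_sq_sum_le` (`(d+2)L·S(c) ≤ C₁·M` when `N(c) ⊆ S`), `remainder_le_linear` (the second-order terms of F5a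
  with `δ = m²/2` are `≤ (159α + 520·m_*)·m` for `0 ≤ m ≤ m_*`, `72m_* ≤ 1`, `0 ≤ α ≤ 1/24`), `sum_sq_le_sq_add` (Minkowski reading).
* §2 ★★★ `exists_regauge_sum_normSq_le` — the title: `∃ g : GaugeTransf P (j+1) SU(2)`,
  `Σ_{c∈T} ‖pertVar (avgFun ℰ V) (gaugeAct g (avgFun ℰ W)) c‖² ≤ ((ρ + κ·(159α + 520·C₁M))·M)²`, under `72·C₁M ≤ 1`, `3C₁M + α < δ_2`, ROW-L, ROW-M.
HONEST SCOPE.  Bookkeeping over F5a ∕ F5b-1 ∕ E10's `nbhdMass_sq_le` and Minkowski; ROW-L∕ROW-M displayed; one level; nothing of [Balaban1985Averaging]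
is asserted beyond the cited tree theorems.

References: T. Bałaban, CMP 98 (1985) 17–51 [Balaban1985Averaging] (Prop. 3 (122)–(126) p.36, §3 (156)–(163)); CMP 95 (1984) 17–40
[Balaban1984PropagatorsI] ((1.18)–(1.20) pp.19–20); CMP 109 (1987) 249–301 [Balaban1987RG1] ((0.3)–(0.4) pp.252–253).
-/

noncomputable section

open scoped BigOperators Matrix.Norms.L2Operator
open NormedSpace

namespace Summit.QuantumFields.YangMills.Theorems.PoincareLipschitzRegaugedTowerStep

open Literature.MathematicalPhysics.QuantumFieldTheory.Balaban1983to89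
open Finset T4Continuum BlockAveraging AveragingRT ExpMeanLog BlockAveragingEMLLinearised BlockAveragingEMLLinearisedBackground BlockAveragingEMLProp2
open Summit.QuantumFields.YangMills.Theorems.PoincareLipschitzRegaugedStep (norm_pertVar_avgFun_regauged_le_nbhdMass)
open Summit.QuantumFields.YangMills.Theorems.PoincareLipschitzSkewProjection (norm_combMean_skewPart_sub_le_nbhdMass su_combMean_skewPart)
open Summit.QuantumFields.YangMills.Theorems.PoincareLipschitzRegaugeAbsorption (exists_gaugeTransf_coe_eq_exp_neg)
open Summit.QuantumFields.YangMills.Theorems.Prop7FibreRemainderL1Level (nbhdMass_sq_le)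
open Summit.QuantumFields.YangMills.Theorems.Prop7TrueLinIterDefect (sqrt_sum_norm_add_sq_le)

variable {P : Params} {j : ℕ}

/-! ## §1 Letters -/

/-- Sums of a nonnegative function over the two-block neighbourhood of `c` are bounded by the sums over any `S ⊇ N(c)`. [folklore] -/
theorem sum_le_sum_of_nbhd_subset {c : PBond P (j + 1)} {S : Finset (PBond P j)}
    (hS : ∀ b : PBond P j, (blockOf b.src = c.src ∨ blockOf b.src = c.tgt) → b ∈ S) (g : PBond P j → ℝ) (hg : ∀ b, 0 ≤ g b) :
    ∑ b ∈ univ.filter (fun b : PBond P j => blockOf b.src = c.src ∨ blockOf b.src = c.tgt), g b ≤ ∑ b ∈ S, g b :=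
  Finset.sum_le_sum_of_subset_of_nonneg (fun b hb => hS b (Finset.mem_filter.1 hb).2) fun b _ _ => hg b

/-- **`m(c) = (d+2)L·S(c) ≤ C₁·M`**, `C₁ = (d+2)L·√(2dL^d)`, whenever `N(c) ⊆ S` and `Σ_{b∈S}‖Y b‖² ≤ M²` (✓`nbhdMass_sq_le`). [folklore] -/
theorem nbhdMass_le_of_sq_sum_le (hj : j + 1 ≤ P.m + P.K) (Y : PBond P j → Matrix (Fin 2) (Fin 2) ℂ) (c : PBond P (j + 1))
    {S : Finset (PBond P j)} (hS : ∀ b : PBond P j, (blockOf b.src = c.src ∨ blockOf b.src = c.tgt) → b ∈ S) {M : ℝ} (hM0 : 0 ≤ M)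
    (hM : ∑ b ∈ S, ‖Y b‖ ^ 2 ≤ M ^ 2) :
    (((P.d + 2) * P.L : ℕ) : ℝ) * ∑ b ∈ univ.filter (fun b : PBond P j => blockOf b.src = c.src ∨ blockOf b.src = c.tgt), ‖Y b‖
      ≤ (((P.d + 2) * P.L : ℕ) : ℝ) * Real.sqrt (2 * P.d * (P.L : ℝ) ^ P.d) * M := by
  have h1 := nbhdMass_sq_le hj Y c
  have h2 : ∑ b ∈ univ.filter (fun b : PBond P j => blockOf b.src = c.src ∨ blockOf b.src = c.tgt), ‖Y b‖ ^ 2 ≤ M ^ 2 :=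
    (sum_le_sum_of_nbhd_subset hS (fun b => ‖Y b‖ ^ 2) fun b => sq_nonneg _).trans hM
  have hC : (0 : ℝ) ≤ 2 * P.d * (P.L : ℝ) ^ P.d := by positivity
  have hS0 : 0 ≤ ∑ b ∈ univ.filter (fun b : PBond P j => blockOf b.src = c.src ∨ blockOf b.src = c.tgt), ‖Y b‖ :=
    Finset.sum_nonneg fun _ _ => norm_nonneg _
  have h3 : (∑ b ∈ univ.filter (fun b : PBond P j => blockOf b.src = c.src ∨ blockOf b.src = c.tgt), ‖Y b‖) ^ 2
      ≤ (Real.sqrt (2 * P.d * (P.L : ℝ) ^ P.d) * M) ^ 2 := by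
    rw [mul_pow, Real.sq_sqrt hC]
    exact h1.trans (mul_le_mul_of_nonneg_left h2 hC)
  have h4 : ∑ b ∈ univ.filter (fun b : PBond P j => blockOf b.src = c.src ∨ blockOf b.src = c.tgt), ‖Y b‖
      ≤ Real.sqrt (2 * P.d * (P.L : ℝ) ^ P.d) * M :=
    (pow_le_pow_iff_left₀ hS0 (by positivity) two_ne_zero).1 h3
  rw [mul_assoc]
  exact mul_le_mul_of_nonneg_left h4 (by positivity)

/-- **The second-order terms of the re-gauged step are linear in `m` with a small slope**: for `0 ≤ m ≤ m⋆`, `72m⋆ ≤ 1`, `0 ≤ α ≤ 1/24`, `δ = m²/2`: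
`159αm + 260m² + 2δ + 8(m+δ)(3m + 159αm + 260m² + (m+δ)) ≤ (159α + 520m⋆)·m`. [folklore] -/
theorem remainder_le_linear {m ms α : ℝ} (hm0 : 0 ≤ m) (hm : m ≤ ms) (hms : 72 * ms ≤ 1) (hα0 : 0 ≤ α) (hα : α ≤ 1 / 24) :
    159 * α * m + 260 * m ^ 2 + 2 * (m ^ 2 / 2) + 8 * (m + m ^ 2 / 2) * (3 * m + 159 * α * m + 260 * m ^ 2 + (m + m ^ 2 / 2))
      ≤ (159 * α + 520 * ms) * m := by
  have hm72 : m ≤ 1 / 72 := by linarith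
  have hmm : m * m ≤ ms * m := mul_le_mul_of_nonneg_right hm hm0
  -- the bracket is `≤ 16m`, the factor `m + δ ≤ 2m`
  have hδ : m ^ 2 / 2 ≤ m := by nlinarith
  have hbr : 3 * m + 159 * α * m + 260 * m ^ 2 + (m + m ^ 2 / 2) ≤ 16 * m := by nlinarith
  have hfac : m + m ^ 2 / 2 ≤ 2 * m := by linarith
  have hbr0 : 0 ≤ 3 * m + 159 * α * m + 260 * m ^ 2 + (m + m ^ 2 / 2) := by positivity
  have hprod : 8 * (m + m ^ 2 / 2) * (3 * m + 159 * α * m + 260 * m ^ 2 + (m + m ^ 2 / 2)) ≤ 8 * (2 * m) * (16 * m) := by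
    have := mul_le_mul hfac hbr hbr0 (by positivity)
    linarith
  nlinarith

/-- **Minkowski reading**: if `0 ≤ F c ≤ a c + b c` on a finset, `Σ a² ≤ A²`, `Σ b² ≤ B²`, `A, B ≥ 0`, then `Σ F² ≤ (A + B)²`. [folklore] -/
theorem sum_sq_le_sq_add {ι : Type*} (T : Finset ι) {F a b : ι → ℝ} {A B : ℝ} (hA : 0 ≤ A) (hB : 0 ≤ B)
    (hF0 : ∀ c ∈ T, 0 ≤ F c) (hF : ∀ c ∈ T, F c ≤ a c + b c)
    (ha : ∑ c ∈ T, a c ^ 2 ≤ A ^ 2) (hb : ∑ c ∈ T, b c ^ 2 ≤ B ^ 2) :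
    ∑ c ∈ T, F c ^ 2 ≤ (A + B) ^ 2 := by
  -- pass to the subtype `T` and use Minkowski in `PiLp 2`
  have h1 : ∑ c ∈ T, F c ^ 2 ≤ ∑ c ∈ T, (a c + b c) ^ 2 :=
    Finset.sum_le_sum fun c hc => pow_le_pow_left₀ (hF0 c hc) (hF c hc) 2
  have hmink := sqrt_sum_norm_add_sq_le (fun c : T => a c) (fun c : T => b c)
  have ea : ∑ c : T, ‖(fun c : T => a c) c + (fun c : T => b c) c‖ ^ 2 = ∑ c ∈ T, (a c + b c) ^ 2 := by
    rw [← Finset.sum_coe_sort T]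
    exact Finset.sum_congr rfl fun c _ => by rw [Real.norm_eq_abs, sq_abs]
  have eb : ∑ c : T, ‖(fun c : T => a c) c‖ ^ 2 = ∑ c ∈ T, a c ^ 2 := by
    rw [← Finset.sum_coe_sort T]
    exact Finset.sum_congr rfl fun c _ => by rw [Real.norm_eq_abs, sq_abs]
  have ec : ∑ c : T, ‖(fun c : T => b c) c‖ ^ 2 = ∑ c ∈ T, b c ^ 2 := by
    rw [← Finset.sum_coe_sort T]
    exact Finset.sum_congr rfl fun c _ => by rw [Real.norm_eq_abs, sq_abs]
  rw [ea, eb, ec] at hmink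
  have hsa : Real.sqrt (∑ c ∈ T, a c ^ 2) ≤ A := by
    rw [← Real.sqrt_sq hA]; exact Real.sqrt_le_sqrt ha
  have hsb : Real.sqrt (∑ c ∈ T, b c ^ 2) ≤ B := by
    rw [← Real.sqrt_sq hB]; exact Real.sqrt_le_sqrt hb
  have hs : Real.sqrt (∑ c ∈ T, (a c + b c) ^ 2) ≤ A + B := hmink.trans (add_le_add hsa hsb)
  have h0 : 0 ≤ ∑ c ∈ T, (a c + b c) ^ 2 := Finset.sum_nonneg fun _ _ => sq_nonneg _
  have h2 : ∑ c ∈ T, (a c + b c) ^ 2 ≤ (A + B) ^ 2 := by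
    rw [← Real.sq_sqrt h0]
    exact pow_le_pow_left₀ (Real.sqrt_nonneg _) hs 2
  exact h1.trans h2

/-! ## §2 The level step in `ℓ²` -/

/-- ★★★ **ONE LEVEL OF THE RE-GAUGED NONLINEAR TOWER IN `ℓ²`.**  Let `V, W` be level-`j` `SU(2)` fields (`j + 1 ≤ m + K`), `Y = pertVar V W`, `T` a finset
of level-`(j+1)` bonds and `S` a finset of level-`j` bonds containing the two-block neighbourhood of every `c ∈ T`; `Σ_{b∈S}‖Y b‖² ≤ M²`; the (0.4) loop
variables of `V` at the bonds of `T` within `α` of `1`, `0 ≤ α ≤ 1/24`; smallness `72·C₁M ≤ 1`, `3C₁M + α < δ_2` (`C₁ = (d+2)L·√(2dL^d)`); and the two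
box-local rows ROW-L (`Σ_T‖LINE_V Y‖² ≤ (L^d)⁻¹L²·Σ_S‖Y‖²`) and ROW-M (`Σ_T Σ_{N(c)} g ≤ 2d·Σ_S g`, `g ≥ 0`).  Then for SOME level-`(j+1)` gauge transformation
`g` (namely `exp(−CM_Z)`, `Z` the skew projection of `Y`):
`Σ_{c∈T} ‖pertVar (avgFun ℰ V) (gaugeAct g (avgFun ℰ W)) c‖² ≤ ((ρ + κ·(159α + 520·C₁M))·M)²`, `ρ = √((L^d)⁻¹L²)`, `κ = (d+2)L·√((2dL^d)(2d))`.
[cite: Balaban1985Averaging, Prop. 3 (122)-(126) p.36] -/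
theorem exists_regauge_sum_normSq_le (hj : j + 1 ≤ P.m + P.K) (V W : GaugeField P j (Matrix.specialUnitaryGroup (Fin 2) ℂ))
    (T : Finset (PBond P (j + 1))) (S : Finset (PBond P j))
    (hS : ∀ c ∈ T, ∀ b : PBond P j, (blockOf b.src = c.src ∨ blockOf b.src = c.tgt) → b ∈ S)
    {M α : ℝ} (hM0 : 0 ≤ M) (hM : ∑ b ∈ S, ‖pertVar V W b‖ ^ 2 ≤ M ^ 2)
    (hα0 : 0 ≤ α) (hα : ∀ c ∈ T, ∀ i : Idx P, dist1 (loopHol V c i) ≤ α) (hα24 : α ≤ 1 / 24)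
    (hsmall : 72 * ((((P.d + 2) * P.L : ℕ) : ℝ) * Real.sqrt (2 * P.d * (P.L : ℝ) ^ P.d) * M) ≤ 1)
    (hN : 3 * ((((P.d + 2) * P.L : ℕ) : ℝ) * Real.sqrt (2 * P.d * (P.L : ℝ) ^ P.d) * M) + α < deltaSU (Fin 2))
    (hRowL : ∑ c ∈ T, ‖((Fintype.card (Idx P) : ℂ))⁻¹ • ∑ i : Idx P,
        ((holAt V (walk (emb c.src) (stairWord i.2.1 (off i.1))) : Matrix.specialUnitaryGroup (Fin 2) ℂ) : Matrix (Fin 2) (Fin 2) ℂ) *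
          covWalkSum V (pertVar V W) (walk (walkEnd (emb c.src) (stairWord i.2.1 (off i.1))) (List.replicate P.L (c.dir, true))) *
        star ((holAt V (walk (emb c.src) (stairWord i.2.1 (off i.1))) : Matrix.specialUnitaryGroup (Fin 2) ℂ) : Matrix (Fin 2) (Fin 2) ℂ)‖ ^ 2
      ≤ ((P.L : ℝ) ^ P.d)⁻¹ * (P.L : ℝ) ^ 2 * ∑ b ∈ S, ‖pertVar V W b‖ ^ 2)
    (hRowM : ∀ g : PBond P j → ℝ, (∀ b, 0 ≤ g b) →
      ∑ c ∈ T, ∑ b ∈ univ.filter (fun b : PBond P j => blockOf b.src = c.src ∨ blockOf b.src = c.tgt), g b ≤ 2 * P.d * ∑ b ∈ S, g b) :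
    ∃ g : GaugeTransf P (j + 1) (Matrix.specialUnitaryGroup (Fin 2) ℂ),
      ∑ c ∈ T, ‖pertVar (avgFun (expMeanLogSU (n := Fin 2)) V) (GaugeField.gaugeAct g (avgFun (expMeanLogSU (n := Fin 2)) W)) c‖ ^ 2 ≤
        ((Real.sqrt (((P.L : ℝ) ^ P.d)⁻¹ * (P.L : ℝ) ^ 2)
          + (((P.d + 2) * P.L : ℕ) : ℝ) * Real.sqrt (2 * P.d * (P.L : ℝ) ^ P.d * (2 * P.d))
            * (159 * α + 520 * ((((P.d + 2) * P.L : ℕ) : ℝ) * Real.sqrt (2 * P.d * (P.L : ℝ) ^ P.d) * M))) * M) ^ 2 := by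
  -- letters
  set Y : PBond P j → Matrix (Fin 2) (Fin 2) ℂ := pertVar V W with hYdef
  set Z : PBond P j → Matrix (Fin 2) (Fin 2) ℂ := fun b => (2 : ℂ)⁻¹ • (pertVar V W b - star (pertVar V W b)) with hZdef
  set ξ : Site P (j + 1) → Matrix (Fin 2) (Fin 2) ℂ := fun y =>
    ((Fintype.card (Idx P) : ℂ))⁻¹ • ∑ i : Idx P, covWalkSum V Z (walk (emb y) (stairWord i.2.1 (off i.1))) with hξdef
  set ℓ : ℝ := (((P.d + 2) * P.L : ℕ) : ℝ) with hℓ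
  set C₁ : ℝ := ℓ * Real.sqrt (2 * P.d * (P.L : ℝ) ^ P.d) with hC₁
  set ms : ℝ := C₁ * M with hms
  set ρ : ℝ := Real.sqrt (((P.L : ℝ) ^ P.d)⁻¹ * (P.L : ℝ) ^ 2) with hρ
  set κ : ℝ := ℓ * Real.sqrt (2 * P.d * (P.L : ℝ) ^ P.d * (2 * P.d)) with hκ
  set q : ℝ := 159 * α + 520 * ms with hq
  have hℓ0 : 0 ≤ ℓ := by positivity
  have hC₁0 : 0 ≤ C₁ := by positivity
  have hms0 : 0 ≤ ms := by positivity
  have hms72 : 72 * ms ≤ 1 := by simpa only [hms, hC₁, hℓ, mul_assoc] using hsmall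
  have hmsN : 3 * ms + α < deltaSU (Fin 2) := by simpa only [hms, hC₁, hℓ, mul_assoc] using hN
  have hq0 : 0 ≤ q := by positivity
  have hρ0 : 0 ≤ ρ := Real.sqrt_nonneg _
  have hκ0 : 0 ≤ κ := by positivity
  -- the gauge transformation `g = exp(−ξ)`
  have hξsu : ∀ y, star (ξ y) = -ξ y ∧ (ξ y).trace = 0 := fun y => su_combMean_skewPart V W y
  obtain ⟨g, hg⟩ := exists_gaugeTransf_coe_eq_exp_neg ξ hξsu
  refine ⟨g, ?_⟩
  -- the two-block mass `m(c) = ℓ·S(c)` and its bound `≤ ms` on `T`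
  set Sm : PBond P (j + 1) → ℝ := fun c => ∑ b ∈ univ.filter (fun b : PBond P j => blockOf b.src = c.src ∨ blockOf b.src = c.tgt), ‖Y b‖ with hSm
  have hSm0 : ∀ c, 0 ≤ Sm c := fun c => Finset.sum_nonneg fun _ _ => norm_nonneg _
  have hmc : ∀ c ∈ T, ℓ * Sm c ≤ ms := fun c hc => by
    have := nbhdMass_le_of_sq_sum_le hj Y c (hS c hc) hM0 hM
    simpa only [hms, hC₁, hℓ, hSm, mul_assoc] using this
  -- pointwise: the re-gauged ratio at `c ∈ T`
  set LINE : PBond P (j + 1) → Matrix (Fin 2) (Fin 2) ℂ := fun c => ((Fintype.card (Idx P) : ℂ))⁻¹ • ∑ i : Idx P,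
        ((holAt V (walk (emb c.src) (stairWord i.2.1 (off i.1))) : Matrix.specialUnitaryGroup (Fin 2) ℂ) : Matrix (Fin 2) (Fin 2) ℂ) *
          covWalkSum V Y (walk (walkEnd (emb c.src) (stairWord i.2.1 (off i.1))) (List.replicate P.L (c.dir, true))) *
        star ((holAt V (walk (emb c.src) (stairWord i.2.1 (off i.1))) : Matrix.specialUnitaryGroup (Fin 2) ℂ) : Matrix (Fin 2) (Fin 2) ℂ)
    with hLINE
  have hpt : ∀ c ∈ T,
      ‖pertVar (avgFun (expMeanLogSU (n := Fin 2)) V) (GaugeField.gaugeAct g (avgFun (expMeanLogSU (n := Fin 2)) W)) c‖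
        ≤ ‖LINE c‖ + q * (ℓ * Sm c) := by
    intro c hc
    have hm := hmc c hc
    have hm0 : 0 ≤ ℓ * Sm c := mul_nonneg hℓ0 (hSm0 c)
    have hm72 : 72 * (ℓ * Sm c) ≤ 1 := by nlinarith
    have hmN : 3 * (ℓ * Sm c) + α < deltaSU (Fin 2) := by linarith
    have hδm := norm_combMean_skewPart_sub_le_nbhdMass hj V W c c.src (Or.inl rfl)
    have hδp := norm_combMean_skewPart_sub_le_nbhdMass hj V W c c.tgt (Or.inr rfl)
    have hmδ : ℓ * Sm c + (ℓ * Sm c) ^ 2 / 2 ≤ 1 := by nlinarith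
    have h := norm_pertVar_avgFun_regauged_le_nbhdMass hj V W c (δ := (ℓ * Sm c) ^ 2 / 2)
      (by simpa only [hℓ, hSm, hYdef] using hm72) (hα c hc) hα24 (by simpa only [hℓ, hSm, hYdef] using hmN)
      (by simpa only [hℓ, hSm, hYdef, hξdef, hZdef] using hδm) (by simpa only [hℓ, hSm, hYdef, hξdef, hZdef] using hδp)
      (by simpa only [hℓ, hSm, hYdef] using hmδ) g (hg c.src) (hg c.tgt)
    have hrem := remainder_le_linear hm0 hm hms72 hα0 hα24
    have h' : ‖pertVar (avgFun (expMeanLogSU (n := Fin 2)) V) (GaugeField.gaugeAct g (avgFun (expMeanLogSU (n := Fin 2)) W)) c‖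
        ≤ ‖LINE c‖ + (159 * α * (ℓ * Sm c) + 260 * (ℓ * Sm c) ^ 2 + 2 * ((ℓ * Sm c) ^ 2 / 2)
          + 8 * (ℓ * Sm c + (ℓ * Sm c) ^ 2 / 2) * (3 * (ℓ * Sm c) + 159 * α * (ℓ * Sm c) + 260 * (ℓ * Sm c) ^ 2
            + (ℓ * Sm c + (ℓ * Sm c) ^ 2 / 2))) := by
      have e := h
      simp only [hℓ, hSm, hYdef, hLINE] at e ⊢
      linarith
    linarith
  -- `ℓ²(T)`: Minkowski with ROW-L and ROW-M
  have hLINE_sq : ∑ c ∈ T, ‖LINE c‖ ^ 2 ≤ (ρ * M) ^ 2 := by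
    have h1 : ∑ c ∈ T, ‖LINE c‖ ^ 2 ≤ ((P.L : ℝ) ^ P.d)⁻¹ * (P.L : ℝ) ^ 2 * ∑ b ∈ S, ‖Y b‖ ^ 2 := by
      simpa only [hLINE, hYdef] using hRowL
    have hc0 : (0 : ℝ) ≤ ((P.L : ℝ) ^ P.d)⁻¹ * (P.L : ℝ) ^ 2 := by positivity
    rw [mul_pow, hρ, Real.sq_sqrt hc0]
    exact h1.trans (mul_le_mul_of_nonneg_left hM hc0)
  have hmass_sq : ∑ c ∈ T, (q * (ℓ * Sm c)) ^ 2 ≤ (κ * q * M) ^ 2 := by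
    -- `Σ_T (ℓ S(c))² ≤ ℓ²·(2dL^d)·Σ_T Σ_{N(c)} ‖Y‖² ≤ ℓ²·(2dL^d)(2d)·M²`
    have h1 : ∀ c ∈ T, (Sm c) ^ 2 ≤ (2 * P.d * (P.L : ℝ) ^ P.d) *
        ∑ b ∈ univ.filter (fun b : PBond P j => blockOf b.src = c.src ∨ blockOf b.src = c.tgt), ‖Y b‖ ^ 2 :=
      fun c _ => by simpa only [hSm] using nbhdMass_sq_le hj Y c
    have h2 := hRowM (fun b => ‖Y b‖ ^ 2) (fun b => sq_nonneg _)
    have hC : (0 : ℝ) ≤ 2 * P.d * (P.L : ℝ) ^ P.d := by positivity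
    have h3 : ∑ c ∈ T, (Sm c) ^ 2 ≤ (2 * P.d * (P.L : ℝ) ^ P.d) * (2 * P.d * ∑ b ∈ S, ‖Y b‖ ^ 2) := by
      calc ∑ c ∈ T, (Sm c) ^ 2 ≤ ∑ c ∈ T, (2 * P.d * (P.L : ℝ) ^ P.d) *
            ∑ b ∈ univ.filter (fun b : PBond P j => blockOf b.src = c.src ∨ blockOf b.src = c.tgt), ‖Y b‖ ^ 2 := Finset.sum_le_sum h1
        _ = (2 * P.d * (P.L : ℝ) ^ P.d) * ∑ c ∈ T,
            ∑ b ∈ univ.filter (fun b : PBond P j => blockOf b.src = c.src ∨ blockOf b.src = c.tgt), ‖Y b‖ ^ 2 := by rw [Finset.mul_sum]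
        _ ≤ (2 * P.d * (P.L : ℝ) ^ P.d) * (2 * P.d * ∑ b ∈ S, ‖Y b‖ ^ 2) := mul_le_mul_of_nonneg_left h2 hC
    have h4 : ∑ c ∈ T, (Sm c) ^ 2 ≤ (2 * P.d * (P.L : ℝ) ^ P.d * (2 * P.d)) * M ^ 2 := by
      have : (2 * P.d * (P.L : ℝ) ^ P.d) * (2 * P.d * ∑ b ∈ S, ‖Y b‖ ^ 2) ≤ (2 * P.d * (P.L : ℝ) ^ P.d * (2 * P.d)) * M ^ 2 := by
        have hd0 : (0 : ℝ) ≤ 2 * P.d := by positivity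
        nlinarith [mul_le_mul_of_nonneg_left hM (mul_nonneg hC hd0)]
      exact h3.trans this
    have e : ∑ c ∈ T, (q * (ℓ * Sm c)) ^ 2 = (q * ℓ) ^ 2 * ∑ c ∈ T, (Sm c) ^ 2 := by
      rw [Finset.mul_sum]; exact Finset.sum_congr rfl fun c _ => by ring
    have hK : (0 : ℝ) ≤ 2 * P.d * (P.L : ℝ) ^ P.d * (2 * P.d) := by positivity
    have hκ2 : κ ^ 2 = ℓ ^ 2 * (2 * P.d * (P.L : ℝ) ^ P.d * (2 * P.d)) := by rw [hκ, mul_pow, Real.sq_sqrt hK]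
    rw [e]
    calc (q * ℓ) ^ 2 * ∑ c ∈ T, (Sm c) ^ 2 ≤ (q * ℓ) ^ 2 * ((2 * P.d * (P.L : ℝ) ^ P.d * (2 * P.d)) * M ^ 2) :=
          mul_le_mul_of_nonneg_left h4 (sq_nonneg _)
      _ = (κ * q * M) ^ 2 := by rw [show (κ * q * M) ^ 2 = κ ^ 2 * (q ^ 2 * M ^ 2) by ring, hκ2]; ring
  have hmain := sum_sq_le_sq_add T (F := fun c =>
      ‖pertVar (avgFun (expMeanLogSU (n := Fin 2)) V) (GaugeField.gaugeAct g (avgFun (expMeanLogSU (n := Fin 2)) W)) c‖)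
    (a := fun c => ‖LINE c‖) (b := fun c => q * (ℓ * Sm c)) (A := ρ * M) (B := κ * q * M)
    (mul_nonneg hρ0 hM0) (by positivity) (fun c _ => norm_nonneg _) hpt hLINE_sq hmass_sq
  refine hmain.trans (le_of_eq ?_)
  simp only [hρ, hκ, hq, hms, hC₁, hℓ]
  ring

end Summit.QuantumFields.YangMills.Theorems.PoincareLipschitzRegaugedTowerStep

end
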